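import Summits.HodgeConjecture.HodgeConjecture.Theorems.Ring2AbelianAllSpread
import Summits.HodgeConjecture.HodgeConjecture.Theorems.WeilTypeLadderCMReduction
import HarnessLib

/-!
# Ring 2 · AbelianAll · SPREAD axis, part 2 — the brief's spreading sentence DOMINATES `HC_CM`
# (densely anchored Weil families)

HONEST FRAMING: research route, not a corollary; conditional on HC_CM plus one named minimal statement.
(Cell-wide: research route conditional on HC_CM; not a corollary; Q11.4-sentence-2 already refuted in dim ≥ 3.)

Cell `pub-hodge-ring2`, sub-cell AbelianAll, seat `pub-hodge-ring2-ab-spread-1`; companion of `Ring2AbelianAllSpread`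
(§1–§3: the candidates `S_ZD ⟹ U_Z ⟹ U` and their exactness as complements of `HC_CM`). `HC_CM` =
`Theses.RankFourFaces.CMAbelianHodge` is a binder wherever it occurs, never an axiom; `HC_AV` =
`Theses.PadicSemiregularLift.HodgeAbelianVarieties`; item 16267 `CMToAbelian` is not re-filed. Nothing here proves a
case of the Hodge conjecture. Sorry-free; axioms `propext`, `Classical.choice`, `Quot.sound` only.

## What this file proves (§4 of the seat's spread census)

The AbelianAll brief's spreading example S_ZD = `SpreadFromZariskiDenseCMPoints` ("a flat section … algebraic at a
Zariski-dense SET of CM points is algebraic everywhere") makes `HC_CM` IDLE: granted André 1992 (tree fact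
`Andre1992_hodgeClasses_cmAbelianVariety_mem_span_pullback_weilClasses`: Hodge classes on a CM abelian variety are sums
of pull-backs of Weil classes) and two typed DENSELY-ANCHORED Weil-family hypotheses —
`DenselyAnchoredWeilFamiliesImaginaryQuadratic` (Deligne's Weil family through `A` contains the points `A₀ ⊗ E`, "`A₀`
ANY abelian variety of dimension `d/2`", with algebraic Weil classes; `A₀` CM makes them CM anchors) and
`DenselyAnchoredWeilFamiliesCMField` (André's Hodge-type family contains a fibre isogenous to a power of an elliptic
curve, where `B = D` — Tate / [KuM91] §2), each with the INFERENCE (ours) that the anchor may be taken of CM type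
(`A₀`, resp. the elliptic curve, with complex multiplication) and that the Hecke translates of such anchors are
Zariski-dense (real approximation) — one gets `S_ZD ⟹ WeilClassesImaginaryQuadratic ∧ WeilClassesCMField ⟹ HC_CM`
(`HC_CM_of_denselyAnchored_of_spreadZD`), hence `HC_AV ↔ S_ZD` and `(HC_CM ∧ S_ZD) ↔ S_ZD`. The densely-anchored
inputs are typed Summit-side hypotheses (print + inference, never cited as facts) and are ON-PATH (`HC_AV ⟹` each,
granted the refereed family fact `deligne1982_cmDenseMumfordTateFamilies`). Contrast: the premise-at-ALL-CM-fibres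
forms U_Z and U (deform's `UniformAlgebraicityAtCMPoints`) are not visibly dominating — the reason U, not S_ZD, is the
spread-side `B_min` next to which `HC_CM` stays load-bearing.

References: [Deligne1982HodgeCycles] Thm. 4.8 (proof, pp. 50–51: "there is also an abelian variety of the form
`A₀ ⊗ E` in the family … Let `A₀` be any abelian variety of dimension `d/2`"), Prop. 6.1; [Andre1992HodgeCM];
[Andre1996Motifs] §6.3 Lemmes 6.3.2–6.3.3, Remarque 2; [vanGeemen1994HodgeAV] Thm. 4.3 (Tate: `B = D` for varieties
isogenous to products of elliptic curves), 5.3–5.11; [MoonenZarhin1998WeilClasses] §1; [PlatonovRapinchuk1994]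
Thm. 7.7 (real approximation); [CharlesSchnell2014Notes] Thm. 11.5.11, Cor. 11.3.6; [GreenGriffithsKerr2012] p. 230 ("CM points are dense for
maximal unconstrained variations of Hodge structure") and Conj. (VIII.B.1) (p. 235; André–Oort for motivic VHS — the print
form behind part 1's `ZariskiDenseCMLocusIsDense`). PerL / QW8 / the 2001 programme are cited nowhere.
-/

-- every declaration of this problem lives in `Summit.HodgeConjecture.HodgeConjecture.…` (summit = sub-problem).
set_option linter.dupNamespace false

noncomputable section

namespace Summit.HodgeConjecture.HodgeConjecture.Ring2.AbelianAll

open CategoryTheory AlgebraicGeometry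
open Literature.AlgebraicGeometry Literature.AlgebraicGeometry.Motives
open Literature.AlgebraicGeometry.HodgeTheory
open Literature.AlgebraicGeometry.Deligne1982 (deligne1982_cmDenseMumfordTateFamilies)
open Literature.AlgebraicTopology.SingularHomology
open Summit.HodgeConjecture.HodgeConjecture
open Summit.HodgeConjecture.HodgeConjecture.WeilTypeLadder
open Summit.HodgeConjecture.HodgeConjecture.Theses
open Summit.HodgeConjecture.HodgeConjecture.Ring2.Deform

/-! ## §4 The brief's example DOMINATES `HC_CM`: densely anchored Weil families -/

/-- **The DENSELY ANCHORED classes of `A` in degree `2p`** (a `Set`-valued definition, not an assertion): the classes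
`c` for which there is a family as in S_ZD's scope through `A` (`e : A.X ≅ 𝒳_{s₁}`), of relative dimension `dim A`, a
global fibrewise rational `(p,p)` class `W` restricting to `c`, and a set `Λ` of CM fibres, Zariski-dense on points,
at each of which `W|_{𝒳_s}` is ALGEBRAIC — unconditionally. The shape of Deligne's Weil families (Thm. 4.8: the
family through `A` contains the points `A₀ ⊗ E`, "`A₀` any abelian variety of dimension `d/2`", whose Weil classes are
algebraic) and of André's Hodge-type families (Lemme 6.3.3: a fibre isogenous to a power of an elliptic curve, where
`B = D` by Tate / [KuM91]), with — our inference, not print — CM anchors of that shape and their Hecke translates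
supplying the Zariski-dense CM set. [cite: Deligne1982HodgeCycles, Thm. 4.8
(proof, pp. 50–51)] [cite: Andre1996Motifs, §6.3 Lemme 6.3.3] [cite: vanGeemen1994HodgeAV, Thm. 4.3] -/
def denselyAnchoredClasses (A : AbelianVariety ℂ) (p : ℕ) : Set (complexBetti A.X (2 * p)) :=
  {c | ∃ (𝒳 S : SchemeOver ℂ) (f : 𝒳 ⟶ S) (s₁ : ComplexPoints S) (e : A.X ≅ fiberOver f s₁)
    (W : complexBetti 𝒳 (2 * p)) (Λ : Set (ComplexPoints S)),
    IsSmoothProjectiveFamily f A.dim ∧ IsQuasiProjectiveOver 𝒳 ∧ IsQuasiProjectiveOver S ∧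
    IrreducibleSpace S.left ∧ AlgebraicGeometry.Smooth S.hom ∧
    (∀ s : ComplexPoints S, ∃ A' : AbelianVariety ℂ, A'.dim = A.dim ∧ Nonempty (A'.X ≅ fiberOver f s)) ∧
    (∀ s : ComplexPoints S, IsRationalClass (complexBetti.map (fiberι f s) (2 * p) W) ∧
      IsOfHodgeType A.dim (fiberOver f s) (2 * p) p p (complexBetti.map (fiberι f s) (2 * p) W)) ∧
    complexBetti.map e.hom (2 * p) (complexBetti.map (fiberι f s₁) (2 * p) W) = c ∧
    Λ ⊆ cmLocus f A.dim ∧ zariskiClosureOnPoints Λ = Set.univ ∧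
    ∀ s ∈ Λ, complexBetti.map (fiberι f s) (2 * p) W ∈ algebraicClasses (fiberOver f s) p}

/-- **S_ZD makes every densely-anchored class algebraic** — with NO `HC_CM`: S_ZD spreads algebraicity from the
anchors to the fibre `𝒳_{s₁} ≅ A`, and algebraic classes transport along the chart
(`mem_algebraicClasses_map_iff_of_iso`).
[cite: CharlesSchnell2014Notes, Conj. 11.3.1] -/
theorem mem_algebraicClasses_of_mem_denselyAnchored_of_spreadZD (hS : SpreadFromZariskiDenseCMPoints)
    {A : AbelianVariety ℂ} {p : ℕ} {c : complexBetti A.X (2 * p)} (h : c ∈ denselyAnchoredClasses A p) :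
    c ∈ algebraicClasses A.X p := by
  obtain ⟨𝒳, S, f, s₁, e, W, Λ, hf, h𝒳, hS', hirr, hsm, hab, hW, hWc, hΛcm, hΛ, hΛalg⟩ := h
  have h₁ := hS f hf h𝒳 hS' hirr hsm hab p W hW Λ hΛcm hΛ hΛalg s₁
  rw [← hWc]
  exact (mem_algebraicClasses_map_iff_of_iso e).2 h₁

/-- **`DenselyAnchoredWeilFamiliesImaginaryQuadratic` (typed HYPOTHESIS; print + an inference, never cited as a
fact).** Every Weil class of the imaginary-quadratic rung R∞ (`WeilTypeLadder.WeilClassesImaginaryQuadratic`: `2 ≤ n`,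
`0 < d`, `dim A = 2n`, `φ² = -d`, `c ∈ weilClassesOf A φ n d` rational of type `(n,n)`) is densely
anchored (`denselyAnchoredClasses`). PRINT: Deligne's level-`n` Weil family `Γ∖B → Γ∖X⁺` through `A` (LNM 900, proof
of Thm. 4.8,
pp. 50–51) contains the points `A₀ ⊗ E` for EVERY `d/2`-dimensional `A₀`, at which the Weil classes are algebraic
(loc. cit.); taking `A₀` of CM type makes the anchor CM. INFERENCE (ours, standard): the `G(ℚ)`-translates of these
points are again `E`-isogenous to such products, hence anchors, and `G(ℚ)` is dense in `G(ℝ)` (real approximation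
for connected groups), so the anchors are dense in `X⁺`, a fortiori Zariski-dense on points in the quotient. Implied
by
`HC_AV` granted the refereed family fact (`denselyAnchoredWeilFamiliesImaginaryQuadratic_of_deligne1982_of_HC_AV`), so
no stronger than the target. NOT asserted. [cite: Deligne1982HodgeCycles, Thm. 4.8 (proof, pp. 50–51) and Prop. 6.1]
[cite: PlatonovRapinchuk1994, Thm. 7.7] [cite: vanGeemen1994HodgeAV, 5.3–5.11 and Thm. 4.3] [status: open] -/
@[conjecture] def DenselyAnchoredWeilFamiliesImaginaryQuadratic : Prop :=
  ∀ (n : ℕ), 2 ≤ n → ∀ (d : ℕ), 0 < d → ∀ (A : AbelianVariety ℂ) (φ : A ⟶ A), A.dim = 2 * n →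
    IsSmoothProjective (2 * n) A.X → φ ≫ φ = -(d • 𝟙 A) →
      ∀ c : complexBetti A.X (2 * n), IsRationalClass c → IsOfHodgeType (2 * n) A.X (2 * n) n n c →
        c ∈ weilClassesOf A φ n d → c ∈ denselyAnchoredClasses A n

/-- **`DenselyAnchoredWeilFamiliesCMField` (typed HYPOTHESIS; print + an inference, never cited as a fact).** Every
`K`-Weil class of the CM-field rung R3 (`WeilTypeLadder.WeilClassesCMField`: `K = ℚ(φ) ≅ ℚ[T]/(P)` a CM field of
degree
`e > 2`, `e·2m = 2 dim A`, `c ∈ weilClassesField A φ P (2m)` rational of type `(m,m)`) is densely anchored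
(`denselyAnchoredClasses`). PRINT: André's Hodge-type family of `Res SU(V,φ)` through the Weil-type variety contains a fibre isogenous to a
power of an elliptic curve (Lemme 6.3.3), where every Hodge class is algebraic ([KuM91] §2; Tate: `B = D` for
varieties isogenous to products of elliptic curves); the one-anchor form is the tree leaf
`WeilTypeLadder.AnchoredWeilFamiliesCMField`. INFERENCE (ours, not print): the elliptic curve may be taken with
complex multiplication, so that the anchor is a CM fibre, and the Hecke / `G(ℚ)`-translates of such anchors are
anchors too and are dense by real approximation. Implied by `HC_AV` granted the refereed family fact. NOT asserted. [cite: Andre1996Motifs, §6.3 Lemme 6.3.3 (printed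
p. 33)] [cite: vanGeemen1994HodgeAV, Thm. 4.3] [cite: PlatonovRapinchuk1994, Thm. 7.7] [status: open] -/
@[conjecture] def DenselyAnchoredWeilFamiliesCMField : Prop :=
  ∀ (A : AbelianVariety ℂ) (φ : A ⟶ A) (P : Polynomial ℤ) (e m : ℕ),
    P.Monic → P.natDegree = e → 2 < e → Irreducible (P.map (Int.castRingHom ℚ)) →
    Polynomial.eval₂ (Int.castRingHom (CategoryTheory.End A)) (φ : CategoryTheory.End A) P = 0 →
    e * (2 * m) = 2 * A.dim →
    (∀ ρ : ℂ, Polynomial.eval₂ (Int.castRingHom ℂ) ρ P = 0 → starRingEnd ℂ ρ ≠ ρ) →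
    (∃ Q : Polynomial ℚ, ∀ ρ : ℂ, Polynomial.eval₂ (Int.castRingHom ℂ) ρ P = 0 →
        Polynomial.eval₂ (algebraMap ℚ ℂ) ρ Q = starRingEnd ℂ ρ) →
      ∀ c ∈ weilClassesField A φ P (2 * m), IsRationalClass c →
        IsOfHodgeType A.dim A.X (2 * m) m m c → c ∈ denselyAnchoredClasses A m

/-- `S_ZD` + densely anchored imaginary-quadratic Weil families ⟹ the rung R∞ (`WeilClassesImaginaryQuadratic`) —
NO `HC_CM`. [cite: Deligne1982HodgeCycles, Thm. 4.8] [cite: CharlesSchnell2014Notes, Thm. 11.5.24] -/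
theorem weilClassesImaginaryQuadratic_of_denselyAnchored_of_spreadZD
    (hD : DenselyAnchoredWeilFamiliesImaginaryQuadratic) (hS : SpreadFromZariskiDenseCMPoints) :
    WeilClassesImaginaryQuadratic :=
  fun n hn d hd A φ hdim hA hφ c hc hpp hw =>
    mem_algebraicClasses_of_mem_denselyAnchored_of_spreadZD hS (hD n hn d hd A φ hdim hA hφ c hc hpp hw)

/-- `S_ZD` + densely anchored `K`-Weil families ⟹ the rung R3 (`WeilClassesCMField`) — NO `HC_CM`.
[cite: Andre1996Motifs, §6.3 Lemme 6.3.3] [cite: MoonenZarhin1998WeilClasses, §1] -/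
theorem weilClassesCMField_of_denselyAnchored_of_spreadZD (hD : DenselyAnchoredWeilFamiliesCMField)
    (hS : SpreadFromZariskiDenseCMPoints) : WeilClassesCMField :=
  fun A φ P e m hP hdeg he hirr hφ hdim hnr hQ c hc hrat hpp =>
    mem_algebraicClasses_of_mem_denselyAnchored_of_spreadZD hS (hD A φ P e m hP hdeg he hirr hφ hdim hnr hQ c hc hrat hpp)

/-- **(D_ZD) `HC_CM_of_denselyAnchored_of_spreadZD` — the brief's spreading sentence PROVES Hodge-for-CM**, granted
André 1992 (tree fact: Hodge classes on a CM abelian variety are sums of pull-backs of Weil classes) and the two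
densely-anchored Weil-family hypotheses: S_ZD gives R∞ and R3 with no `HC_CM`, and the tree edge
`WeilTypeLadder.rankFourFaces_cmAbelianHodge_of_andre_of_rungs` gives `HC_CM`. This is deform part I (D) with "one
algebraic anchor + VHC" replaced by "a Zariski-dense set of CM anchors + S_ZD". Consequence: in
`HC_AV_of_HC_CM_and_spreadZD` the binder `HC_CM` is DOMINATED. [cite: Andre1992HodgeCM, Théorème]
[cite: Andre1996Motifs, §6.3 Lemmes 6.3.2–6.3.3 and Remarque 2] [cite: Deligne1982HodgeCycles, Thm. 4.8] -/
theorem HC_CM_of_denselyAnchored_of_spreadZD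
    (h𝔄 : Andre1992_hodgeClasses_cmAbelianVariety_mem_span_pullback_weilClasses)
    (hDq : DenselyAnchoredWeilFamiliesImaginaryQuadratic) (hDcm : DenselyAnchoredWeilFamiliesCMField)
    (hS : SpreadFromZariskiDenseCMPoints) : RankFourFaces.CMAbelianHodge :=
  rankFourFaces_cmAbelianHodge_of_andre_of_rungs h𝔄
    (weilClassesImaginaryQuadratic_of_denselyAnchored_of_spreadZD hDq hS)
    (weilClassesCMField_of_denselyAnchored_of_spreadZD hDcm hS)

/-- **(M_ZD) `HC_AV` from S_ZD alone — NO Hodge-for-CM hypothesis**, granted the refereed family fact, André 1992 and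
the densely-anchored Weil families: (D_ZD) then §3. [cite: Deligne1982HodgeCycles, Prop. 6.1 and Milne 2003 re-edition
endnote 19] [cite: Andre1996Motifs, §6.3 Remarque 2] -/
theorem HC_AV_of_denselyAnchored_of_spreadZD (hF : deligne1982_cmDenseMumfordTateFamilies)
    (h𝔄 : Andre1992_hodgeClasses_cmAbelianVariety_mem_span_pullback_weilClasses)
    (hDq : DenselyAnchoredWeilFamiliesImaginaryQuadratic) (hDcm : DenselyAnchoredWeilFamiliesCMField)
    (hS : SpreadFromZariskiDenseCMPoints) : PadicSemiregularLift.HodgeAbelianVarieties :=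
  HC_AV_of_HC_CM_and_spreadZD hF (HC_CM_of_denselyAnchored_of_spreadZD h𝔄 hDq hDcm hS) hS

/-- **(E₂_ZD) `HC_AV ↔ S_ZD`** granted the same: the brief's spreading sentence is EXACTLY as strong as the Hodge
conjecture for abelian varieties, and `HC_CM` has dropped out. [cite: CharlesSchnell2014Notes, Cor. 11.3.6]
[cite: Andre1996Motifs, §6.3 Remarque 2] -/
theorem HC_AV_iff_spreadZD (hF : deligne1982_cmDenseMumfordTateFamilies)
    (h𝔄 : Andre1992_hodgeClasses_cmAbelianVariety_mem_span_pullback_weilClasses)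
    (hDq : DenselyAnchoredWeilFamiliesImaginaryQuadratic) (hDcm : DenselyAnchoredWeilFamiliesCMField) :
    PadicSemiregularLift.HodgeAbelianVarieties ↔ SpreadFromZariskiDenseCMPoints :=
  ⟨spreadFromZariskiDenseCMPoints_of_HC_AV, HC_AV_of_denselyAnchored_of_spreadZD hF h𝔄 hDq hDcm⟩

/-- **(E₃_ZD) What `HC_CM` is worth next to S_ZD: nothing** — `(HC_CM ∧ S_ZD) ↔ S_ZD` granted André 1992 and the
densely-anchored Weil families. [cite: Andre1996Motifs, §6.3 Remarque 2] -/
theorem HC_CM_and_spreadZD_iff (h𝔄 : Andre1992_hodgeClasses_cmAbelianVariety_mem_span_pullback_weilClasses)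
    (hDq : DenselyAnchoredWeilFamiliesImaginaryQuadratic) (hDcm : DenselyAnchoredWeilFamiliesCMField) :
    (RankFourFaces.CMAbelianHodge ∧ SpreadFromZariskiDenseCMPoints) ↔ SpreadFromZariskiDenseCMPoints :=
  ⟨fun h => h.2, fun hS => ⟨HC_CM_of_denselyAnchored_of_spreadZD h𝔄 hDq hDcm hS, hS⟩⟩

/-- ON-PATH for the densely-anchored inputs (so they are no stronger than the target, granted print): under `HC_AV`
the CM-dense Mumford–Tate family through `(A, c)` of the refereed fact densely anchors `c` — its CM locus is dense,
hence Zariski-dense on points, and `HC_AV` makes `W` algebraic at every fibre. [cite: CharlesSchnell2014Notes,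
Thm. 11.5.11 and Cor. 11.3.6] -/
theorem mem_denselyAnchoredClasses_of_deligne1982_of_HC_AV (hF : deligne1982_cmDenseMumfordTateFamilies)
    (h : PadicSemiregularLift.HodgeAbelianVarieties) (A : AbelianVariety ℂ) (hA : IsSmoothProjective A.dim A.X)
    (p : ℕ) (c : complexBetti A.X (2 * p)) (hc : IsRationalClass c) (hpp : IsOfHodgeType A.dim A.X (2 * p) p p c) :
    c ∈ denselyAnchoredClasses A p := by
  obtain ⟨𝒳, S, f, s₁, e, W, hf, h𝒳, hS, hirr, hsm, hab, hW, hWc, hD⟩ :=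
    cmDenseMumfordTateFamilies_of_deligne1982 hF A hA p c hc hpp
  refine ⟨𝒳, S, f, s₁, e, W, cmLocus f A.dim, hf, h𝒳, hS, hirr, hsm, hab, hW, hWc, subset_rfl,
    zariskiClosureOnPoints_eq_univ_of_dense hD, fun s hs => ?_⟩
  exact forall_cmLocus_mem_algebraicClasses_of_HC_CM (HC_CM_of_HC_AV h) f W hW s hs

/-- ON-PATH: `HC_AV ⟹ DenselyAnchoredWeilFamiliesImaginaryQuadratic` granted the refereed family fact.
[cite: CharlesSchnell2014Notes, Thm. 11.5.11] -/
theorem denselyAnchoredWeilFamiliesImaginaryQuadratic_of_deligne1982_of_HC_AV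
    (hF : deligne1982_cmDenseMumfordTateFamilies) (h : PadicSemiregularLift.HodgeAbelianVarieties) :
    DenselyAnchoredWeilFamiliesImaginaryQuadratic := by
  intro n _ d _ A φ hdim hA _ c hc hpp _
  have hA' : IsSmoothProjective A.dim A.X := by rw [hdim]; exact hA
  have hpp' : IsOfHodgeType A.dim A.X (2 * n) n n c := by rw [hdim]; exact hpp
  exact mem_denselyAnchoredClasses_of_deligne1982_of_HC_AV hF h A hA' n c hc hpp'

/-- ON-PATH: `HC_AV ⟹ DenselyAnchoredWeilFamiliesCMField` granted the refereed family fact.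
[cite: CharlesSchnell2014Notes, Thm. 11.5.11] -/
theorem denselyAnchoredWeilFamiliesCMField_of_deligne1982_of_HC_AV
    (hF : deligne1982_cmDenseMumfordTateFamilies) (h : PadicSemiregularLift.HodgeAbelianVarieties) :
    DenselyAnchoredWeilFamiliesCMField := by
  intro A φ P e m _ _ _ _ _ _ _ _ c _ hrat hpp
  exact mem_denselyAnchoredClasses_of_deligne1982_of_HC_AV hF h A
    (AbelianVariety.isSmoothProjective_holds (A := A)) m c hrat hpp

end Summit.HodgeConjecture.HodgeConjecture.Ring2.AbelianAll

end
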